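import Summits.ValiantsHypothesis.ValiantsHypothesis.Theorems.KPlusLogSqLawTropicalGradedWalkPotD

/-!
# Route «KPlusLogSqLaw» — GRW-lite (all-`m` `K = 4` family), dominance certificate, diagonal states of the phases `w < m` — slack lemmas, part 10

HONEST FRAMING.  Helper file of the chain `--supports` the crux `Summit.ValiantsHypothesis.ValiantsHypothesis.Theses.KPlusLogSqLaw.TropicalB`
(item `stmt-ValiantsHypothesis-19771`, route `KPlusLogSqLaw`; cell `pub-symmetroid`, seat val-sym-trop-p3 g14, 2026-08-28), on top of
`…TropicalGradedWalkDefs.lean` / `…TropicalGradedWalkPotD.lean`.  Nothing here bears on `TropicalB` in its window, `WeakLifting`, the doors,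
`MatrixDescartes` or `VP ≠ VNP`.

CONTENT (generated, one lemma per RIVAL FAMILY).  For the diagonal state `(w, u, 0)` (`u < w < m`, slope `thD n w u`) of the GRW-lite design and
a family of rival incidences `(a, b, l)` (parametrised by the column `b`, the row offset `k` / wrap row `a`, …, in one regime of the bend `muD`),
the lemma states the SLACK INEQUALITY of the dual certificate of `TropicalCensus.isDominant_of_scaledPotential` in closed form:
`(θ·d l − v(a,b,l)) + 1 ≤ (UD a − UD r_b) + (θ·d l_b − v(r_b, b, l_b))`, both sides written with the closed-form valuations `v1`, `tau2lt`,
`tau3lt`, `conn` and bends `SUB2`, `SUBu`, `SLB`, `SLB0`.  PROOF SHAPE (uniform): unfold, `push_cast`, and an exact polynomial identity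
(`linear_combination` over the closed forms `two_mul_T2` / `six_mul_T6`) exhibiting `6·(slack − 1)` as (the cast of) a polynomial with
natural-number coefficients in the natural «corner» variables of the family's domain — hence non-negative.  The assembly into `IsDominant` is
in `…GradedWalkDomDGlue.lean`.  Located basis: every lemma was also checked numerically against the exact integer certificate (seat tools
cert3.py / famD.py) for all `m ≤ 9`.
-/

set_option linter.dupNamespace false
set_option autoImplicit false
-- generated certificates use one uniform `simp only` unfolding set; unused entries are expected
set_option linter.unusedSimpArgs false

namespace Summit.ValiantsHypothesis.ValiantsHypothesis.Theorems.LacunarySymmetroidMatrixDescartes.TropicalCensus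

namespace GradedWalk

variable (n : ℕ)

/-- slack lemma of the type-D certificate, rival family `D_past2_2` (see the module docstring). -/
theorem D_past2_2 (w : ℕ) (u : ℕ) (c : ℕ) (E : ℕ) (h2 : (c + u) + 1 ≤ E) (h3 : E + 1 ≤ w) (h4 : w ≤ n) :
    (thD n w u * d2 n - (v1 n (E) (c) + bB n * tau2lt n (E) (c))) + 1 ≤ (thD n w u * d3 n - ((v1 n (E) (c) + bB n * tau2lt n (E) (c)) + tau3lt n (E) (c))) := by
  have hc0 : (c + u) + 1 ≤ E := by omega
  have hc1 : E + 1 ≤ w := by omega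
  have hc2 : w ≤ n := by omega
  have key : (((((((420 * u + 84 * u * c) + (96 * u * c * (w - (E + 1)) + 84 * u * (E - ((c + u) + 1)))) + ((96 * u * (E - ((c + u) + 1)) * (w - (E + 1)) + 528 * u * (w - (E + 1))) + (96 * u * (w - (E + 1)) * (n - (w)) + (96 * u * (w - (E + 1)) * (w - (E + 1)) + 96 * u * (n - (w)))))) + (((48 * u * u + 48 * u * u * (w - (E + 1))) + (336 * c + 72 * c * (E - ((c + u) + 1)))) + ((96 * c * (E - ((c + u) + 1)) * (w - (E + 1)) + 516 * c * (w - (E + 1))) + (96 * c * (w - (E + 1)) * (n - (w)) + (96 * c * (w - (E + 1)) * (w - (E + 1)) + 84 * c * (n - (w))))))) + ((((36 * c * c + 48 * c * c * (w - (E + 1))) + (348 * (E - ((c + u) + 1)) + 516 * (E - ((c + u) + 1)) * (w - (E + 1)))) + ((96 * (E - ((c + u) + 1)) * (w - (E + 1)) * (n - (w)) + 96 * (E - ((c + u) + 1)) * (w - (E + 1)) * (w - (E + 1))) + (84 * (E - ((c + u) + 1)) * (n - (w)) + (36 * (E - ((c + u) + 1)) * (E - ((c + u) + 1)) + 48 *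 (E - ((c + u) + 1)) * (E - ((c + u) + 1)) * (w - (E + 1)))))) + (((1284 * (w - (E + 1)) + 528 * (w - (E + 1)) * (n - (w))) + (48 * (w - (E + 1)) * (n - (w)) * (n - (w)) + 480 * (w - (E + 1)) * (w - (E + 1)))) + ((96 * (w - (E + 1)) * (w - (E + 1)) * (n - (w)) + 48 * (w - (E + 1)) * (w - (E + 1)) * (w - (E + 1))) + (420 * (n - (w)) + (48 * (n - (w)) * (n - (w)) + 780)))))) : ℕ) : ℤ) =
      6 * ((thD n w u * d3 n - ((v1 n (E) (c) + bB n * tau2lt n (E) (c)) + tau3lt n (E) (c))) - ((thD n w u * d2 n - (v1 n (E) (c) + bB n * tau2lt n (E) (c))) + 1)) := by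
    simp only [thD, d1, d2, d3, tau2lt, tau3lt, tau2, tau3, v1, defic, jfun, conn, calpha, cbeta, cgamma, SUB2, SUBu, SLB, SLB0, LL, MM, HH, gG, bB, mZ, AA, M2]
    push_cast [Nat.cast_sub hc0, Nat.cast_sub hc1, Nat.cast_sub hc2, Nat.cast_add, Nat.cast_mul, Nat.cast_ofNat, Nat.cast_one] at *
    ring
  have h6 : (0 : ℤ) ≤ 6 * ((thD n w u * d3 n - ((v1 n (E) (c) + bB n * tau2lt n (E) (c)) + tau3lt n (E) (c))) - ((thD n w u * d2 n - (v1 n (E) (c) + bB n * tau2lt n (E) (c))) + 1)) := key ▸ Int.natCast_nonneg _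
  linarith

end GradedWalk

end Summit.ValiantsHypothesis.ValiantsHypothesis.Theorems.LacunarySymmetroidMatrixDescartes.TropicalCensus
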